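import Summits.MatrixMultiplication.MatrixMultiplication.Theorems.SoloInformedTranslationSchemes
import HarnessLib

/-!
# Few-multiplier TPP stability, I: three flat slices give a TPP normal form

Solo-informed seat (MatrixMultiplication), gen 104; dossier `paper/theoremB2.md` §7 (Theorem C2), step (3).

SETTING (used by the whole `TwistedTPP` series). `S` is a finite abelian group (additive) and the
MULTIPLIER GROUP is an abelian group `A`, WRITTEN ADDITIVELY, acting on `S` by additive automorphisms
`sm : A → (S →+ S)` (`sm (g + h) = sm g ∘ sm h`, `sm 0 = id`); for a translation scheme `𝒮(S, M₀)`
(Cohn–Umans 2013, §5) one takes `A = Additive M₀`. Orbit representatives `a : I → J → S`,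
`b : J → K → S`, `d : K → I → S` of a realization of `⟨|I|,|J|,|K|⟩` (CU13 Def. 12) come with a
PATTERN `(φ i j k, ψ i j k) ∈ A²` solving the matrix-multiplication equations
`a i j + sm (φ i j k) (b j k) + sm (ψ i j k) (d k i) = 0` (`hE`), and with the global half of the
realization property: `a i j + sm μ (b j' k) + sm ν (d k' i') = 0 ⟹ i' = i ∧ j' = j ∧ k' = k` (`hreal`).

`card_box_le_of_flat_slices`: if for a base triple `(i₀, j₀, k₀) ∈ I' × J' × K'` the three pattern
slices through it are FLAT on the box — the `φ`-slice `j = j₀` has trivial holonomy on `I' × K'`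
(`R1`), the `ψ`-slice `i = i₀` on `J' × K'` (`R2`), and the `ψ - φ`-slice `k = k₀` on `I' × J'` (`R3`) —
then `|I'|·|J'|·|K'| ≤ |S|`. Proof: an explicit GAUGE `a' = sm τ a, b' = sm (-σ) b, d' = sm (-ρ) d`
makes the pattern trivial on the three slices; then `a' = f + g`, `b' = l - g`, `d' = -f - l` there and
`(i,j,k) ↦ f i + g j + l k` is injective on the box by `hreal` (the interior equations are never used).
References: CohnUmans2013 (arXiv:1207.6528) Def. 12, §5, Conj. 21; this work (Theorem C2).
-/

noncomputable section

open scoped BigOperators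
open Finset

namespace Summit.MatrixMultiplication.MatrixMultiplication.Theorems.TwistedTPP

/-- `x = y` from `u = v` when `x - y = u - v` (the `abel`-closable rearrangement step). -/
theorem eq_of_sub_eq_sub {M : Type*} [AddCommGroup M] {x y u v : M} (huv : u = v)
    (h : x - y = u - v) : x = y := by
  rw [huv, sub_self] at h; exact sub_eq_zero.mp h

/-- **Three flat slices give a TPP normal form** (Theorem C2, step (3)). With the setting of the module
docstring: if `(i₀,j₀,k₀) ∈ I'×J'×K'` and the holonomies of the `φ`-slice `j₀` on `I'×K'`, of the
`ψ`-slice `i₀` on `J'×K'` and of the `(ψ-φ)`-slice `k₀` on `I'×J'` (all based at the base triple) are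
trivial, then `|I'|·|J'|·|K'| ≤ |S|` (membership `k₀ ∈ K'` is not even needed). [this work, Thm C2 (3)] -/
theorem card_box_le_of_flat_slices {A S I J K : Type*} [AddCommGroup A] [AddCommGroup S] [Fintype S]
    [DecidableEq I] [DecidableEq J] [DecidableEq K]
    (sm : A → S →+ S) (hmul : ∀ g h x, sm (g + h) x = sm g (sm h x)) (hone : ∀ x, sm 0 x = x)
    (a : I → J → S) (b : J → K → S) (d : K → I → S) (φ ψ : I → J → K → A)
    (hE : ∀ i j k, a i j + sm (φ i j k) (b j k) + sm (ψ i j k) (d k i) = 0)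
    (hreal : ∀ (i : I) (j : J) (k : K) (i' : I) (j' : J) (k' : K) (μ ν : A),
      a i j + sm μ (b j' k) + sm ν (d k' i') = 0 → i' = i ∧ j' = j ∧ k' = k)
    (I' : Finset I) (J' : Finset J) (K' : Finset K) {i₀ : I} {j₀ : J} {k₀ : K}
    (hi₀ : i₀ ∈ I') (hj₀ : j₀ ∈ J')
    (R1 : ∀ i ∈ I', ∀ k ∈ K', φ i j₀ k - φ i j₀ k₀ = φ i₀ j₀ k - φ i₀ j₀ k₀)
    (R2 : ∀ j ∈ J', ∀ k ∈ K', ψ i₀ j k - ψ i₀ j k₀ = ψ i₀ j₀ k - ψ i₀ j₀ k₀)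
    (R3 : ∀ i ∈ I', ∀ j ∈ J', (ψ i j k₀ - φ i j k₀) - (ψ i j₀ k₀ - φ i j₀ k₀)
        = (ψ i₀ j k₀ - φ i₀ j k₀) - (ψ i₀ j₀ k₀ - φ i₀ j₀ k₀)) :
    I'.card * J'.card * K'.card ≤ Fintype.card S := by
  -- the gauge `τ, σ, ρ`
  obtain ⟨τ, hτ⟩ : ∃ τ : I → J → A, ∀ i j, τ i j = -(ψ i₀ j k₀ - φ i₀ j k₀) - φ i j k₀ :=
    ⟨_, fun _ _ => rfl⟩
  obtain ⟨σ, hσ⟩ : ∃ σ : J → K → A, ∀ j k, σ j k = -(τ i₀ j + φ i₀ j k) := ⟨_, fun _ _ => rfl⟩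
  obtain ⟨ρ, hρ⟩ : ∃ ρ : K → I → A, ∀ k i, ρ k i = -(τ i j₀ + ψ i j₀ k) := ⟨_, fun _ _ => rfl⟩
  -- the gauged pattern is trivial on the three slices: six identities in `A`
  have G1 : ∀ i j, τ i j + φ i j k₀ = -σ j k₀ := fun i j => by
    rw [hσ, neg_neg, hτ, hτ]; abel
  have G2 : ∀ i ∈ I', ∀ j ∈ J', τ i j + ψ i j k₀ = -ρ k₀ i := fun i hi j hj => by
    rw [hρ, neg_neg, hτ, hτ]
    exact eq_of_sub_eq_sub (R3 i hi j hj) (by abel)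
  have G3 : ∀ j k, τ i₀ j + φ i₀ j k = -σ j k := fun j k => by rw [hσ, neg_neg]
  have G4 : ∀ j ∈ J', ∀ k ∈ K', τ i₀ j + ψ i₀ j k = -ρ k i₀ := fun j hj k hk => by
    rw [hρ, neg_neg, hτ, hτ]
    exact eq_of_sub_eq_sub (R2 j hj k hk) (by abel)
  have G5 : ∀ i ∈ I', ∀ k ∈ K', τ i j₀ + φ i j₀ k = -σ j₀ k := fun i hi k hk => by
    rw [hσ, neg_neg, hτ, hτ]
    exact eq_of_sub_eq_sub (R1 i hi k hk) (by abel)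
  have G6 : ∀ k i, τ i j₀ + ψ i j₀ k = -ρ k i := fun k i => by rw [hρ, neg_neg]
  -- gauged representatives
  obtain ⟨a', ha'⟩ : ∃ a' : I → J → S, ∀ i j, a' i j = sm (τ i j) (a i j) := ⟨_, fun _ _ => rfl⟩
  obtain ⟨b', hb'⟩ : ∃ b' : J → K → S, ∀ j k, b' j k = sm (-σ j k) (b j k) := ⟨_, fun _ _ => rfl⟩
  obtain ⟨d', hd'⟩ : ∃ d' : K → I → S, ∀ k i, d' k i = sm (-ρ k i) (d k i) := ⟨_, fun _ _ => rfl⟩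
  have transport : ∀ i j k, τ i j + φ i j k = -σ j k → τ i j + ψ i j k = -ρ k i →
      a' i j + b' j k + d' k i = 0 := by
    intro i j k h1 h2
    have e := congrArg (sm (τ i j)) (hE i j k)
    rw [map_add, map_add, map_zero, ← hmul, ← hmul, h1, h2] at e
    rw [ha', hb', hd']; exact e
  have E1 : ∀ i ∈ I', ∀ j ∈ J', a' i j + b' j k₀ + d' k₀ i = 0 :=
    fun i hi j hj => transport i j k₀ (G1 i j) (G2 i hi j hj)
  have E2 : ∀ j ∈ J', ∀ k ∈ K', a' i₀ j + b' j k + d' k i₀ = 0 :=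
    fun j hj k hk => transport i₀ j k (G3 j k) (G4 j hj k hk)
  have E3 : ∀ i ∈ I', ∀ k ∈ K', a' i j₀ + b' j₀ k + d' k i = 0 :=
    fun i hi k hk => transport i j₀ k (G5 i hi k hk) (G6 k i)
  -- the normal-form map `(i,j,k) ↦ f i + g j + l k`
  obtain ⟨F, hF⟩ : ∃ F : I × J × K → S,
      ∀ p, F p = -d' k₀ p.1 - b' p.2.1 k₀ + (d' k₀ i₀ - d' p.2.2 i₀) := ⟨_, fun _ => rfl⟩
  have hinj : Set.InjOn F ↑(I' ×ˢ (J' ×ˢ K')) := by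
    rintro ⟨i, j, k⟩ hp ⟨i', j', k'⟩ hp' hFF
    simp only [Finset.coe_product, Set.mem_prod, Finset.mem_coe] at hp hp'
    obtain ⟨hi, hj, hk⟩ := hp
    obtain ⟨hi', hj', hk'⟩ := hp'
    rw [hF, hF] at hFF
    simp only at hFF
    -- the would-be relation `a'(i,j) + b'(j',k) + d'(k',i') = 0`
    have key : a' i j + b' j' k + d' k' i' = 0 := by
      linear_combination (norm := abel) hFF + E1 i hi j hj + E2 j' hj' k hk - E1 i₀ hi₀ j' hj'
        + E3 i' hi' k' hk' - E1 i' hi' j₀ hj₀ - E2 j₀ hj₀ k' hk' + E1 i₀ hi₀ j₀ hj₀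
    -- un-gauge it and apply the realization property
    rw [ha', hb', hd'] at key
    have key2 := congrArg (sm (-τ i j)) key
    rw [map_add, map_add, map_zero, ← hmul, ← hmul, ← hmul, neg_add_cancel, hone] at key2
    obtain ⟨h1, h2, h3⟩ := hreal i j k i' j' k' _ _ key2
    rw [h1, h2, h3]
  have hmaps : Set.MapsTo F ↑(I' ×ˢ (J' ×ˢ K')) ↑(Finset.univ : Finset S) := fun _ _ => by simp
  have h := Finset.card_le_card_of_injOn F hmaps hinj
  simpa [Finset.card_product, Finset.card_univ, mul_assoc] using h

/-- **Holonomy-free form of flatness.** A slice `Φ : I → K → A` is of product form `x i + y k` on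
`I' × K'` as soon as its holonomy based at `(i₀, k₀) ∈ I' × K'` vanishes; conversely product form
gives vanishing holonomy on every rectangle. (Bookkeeping used in part III.) [this work, Thm C2 (1)] -/
theorem flat_iff_product_form {A I K : Type*} [AddCommGroup A] (Φ : I → K → A)
    (I' : Set I) (K' : Set K) {i₀ : I} {k₀ : K} (hi₀ : i₀ ∈ I') (hk₀ : k₀ ∈ K') :
    (∀ i ∈ I', ∀ k ∈ K', Φ i k - Φ i k₀ = Φ i₀ k - Φ i₀ k₀) ↔
      ∃ x : I → A, ∃ y : K → A, ∀ i ∈ I', ∀ k ∈ K', Φ i k = x i + y k := by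
  constructor
  · intro h
    refine ⟨fun i => Φ i k₀ - Φ i₀ k₀, fun k => Φ i₀ k, fun i hi k hk => ?_⟩
    show Φ i k = (Φ i k₀ - Φ i₀ k₀) + Φ i₀ k
    exact eq_of_sub_eq_sub (h i hi k hk) (by abel)
  · rintro ⟨x, y, hxy⟩ i hi k hk
    rw [hxy i hi k hk, hxy i hi k₀ hk₀, hxy i₀ hi₀ k hk, hxy i₀ hi₀ k₀ hk₀]; abel

end Summit.MatrixMultiplication.MatrixMultiplication.Theorems.TwistedTPP
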